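import Literature.MathematicalPhysics.QuantumLattice.HardCoreBosonGroundStateUnique
import Literature.MathematicalPhysics.QuantumLattice.IsingAnisotropicAntiferromagnetPhysicalFrame
import Literature.MathematicalPhysics.QuantumLattice.LiebMattisSectorPF
import Literature.MathematicalPhysics.QuantumLattice.AndersonTowerOfStatesUnconditional
import HarnessLib

/-!
# The XXZ antiferromagnet on the even torus has a unique ground state, with `Sᶻ_tot = 0`
# (every spin, every anisotropy `Δ > 0`) — and the Anderson tower for `0 < Δ ≤ 1`

Koma–Tasaki, J. Stat. Phys. **76** (1994) 745–803, §3.2: for the spin-`S` antiferromagnet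
`h_x = ½Σ_{|x-y|=1}(S¹_xS¹_y + S²_xS²_y + λS³_xS³_y)`, `0 ≤ λ ≤ 1`, on the `d`-dimensional `L × ⋯ × L` torus with `L`
even, «When `L` is finite, the ground state `Φ` of the Hamiltonian is rigorously known [Marshall, Lieb–Mattis,
Affleck–Lieb] to be unique and satisfies `C_Λ Φ = 0` with `C_Λ = Σ_x S³_x`» — hypotheses iv)–vi) of their low-lying-states
Theorem 2.4 / Corollary 2.11 (the Anderson tower).  The tree had this only at the isotropic point `λ = 1`
(`XXZKT.hasUniqueGroundState_heisenbergAF`, Lieb–Mattis; `totalSpin_mulVec_eq_zero_of_heisenberg_groundState`) — where the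
Lieb–Mattis ordering of energy levels (`SU(2)`) is available — and, for `S = ½`, at the `XY` point `λ = 0`
(`HardCoreBoson.hasUniqueGroundState_hardCoreLatticeGas`, Aizenman–Lieb–Seiringer–Solovej–Yngvason 2004, Appendix A).

This file PROVES the statement for EVERY anisotropy `Δ > 0`, every spin `n/2`, `J > 0`, on the even torus
`(ℤ/Lℤ)^d` (`d ≥ 1`), by the argument of [AizenmanEtAl2004] Appendix A («By a Perron–Frobenius argument the ground
state of `H` restricted to the subspace with fixed value of `Σ_x S³_x` is unique. We claim that the absolute ground state
of `H` corresponds to the value `Σ_x S³_x = 0`. To prove this we shall use reflection positivity»), for which the tree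
holds every ingredient:

* §1 (`namespace LiebMattis`) **Perron–Frobenius in the magnetisation sectors of the XXZ antiferromagnet** on any
  connected bipartite graph, any real `Δ` (`LiebMattis.xxz_sector_perronFrobenius`): the anisotropy only changes the real
  DIAGONAL of the matrix in the occupation basis (`xxzHamiltonian_apply_of_ne`), so the proof of the tree's
  `LiebMattis.sector_perronFrobenius` (Marshall signs, ergodicity `reflTransGen_subtype`, abstract
  `perronFrobenius_groundState_unique`) goes through verbatim; plus block-diagonality (`xxzHamiltonian_mulVec_component`).
* §2 (`namespace XXZKT`) **the reflection-positive Kronecker picture**: the odd-sublattice half-turn about the `y`-axis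
  (`exists_productOp_conj_xxzHamiltonian`, Fröhlich–Lieb / DLS / KLS) conjugates `H^{XXZ}_{J,Δ}` into `(JΔ)·H♭`, `H♭` the
  tree's real rotated form `xyzRealFieldHamiltonian L n Δ⁻¹ (-Δ⁻¹) 0`, whose Kennedy–Lieb–Shastry / Björnberg–Ueltschi
  Kronecker form along a pair of planes (`xyzRealFieldHamiltonian_eq_submatrix`) is `A ⊗ 1 + 1 ⊗ A - Σᵢ Mᵢ ⊗ Mᵢ` with
  REAL `A`, `Mᵢ` (rescaled by `JΔ = r²`, `smul_kroneckerForm`); the same unitary turns `Sᶻ_tot` into the STAGGERED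
  magnetisation, which is `F_ε ⊗ 1 - 1 ⊗ F_ε` (`stagCharge_eq_submatrix`, every spin; the reflection exchanges the
  sublattices).
* §3 **the ground state**: a ground state with `Sᶻ_tot = 0` EXISTS (`exists_groundState_totalSpin_eq_zero_xxzAF`, the
  Dyson–Lieb–Simon positive ground state via `Matrix.liebSchupp_exists_groundState_annihilated`), so the sector `Sᶻ_tot = 0`
  realises the ground energy (`lowestEnergyInSector_zero_eq_groundEnergy_xxzAF`) and ground states in it are unique
  (`groundState_totalSpin_zero_unique_xxzAF`, §1); the ALSSY polar-decomposition lemma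
  `Matrix.kroneckerGroundState_charge_eigenvalue_eq_zero` then forces EVERY ground-state eigenvector of `Sᶻ_tot` to have
  eigenvalue `0` (`groundState_totalSpin_eigenvalue_eq_zero_xxzAF`), hence the ground space lies in the sector
  (`groundState_totalSpin_eq_zero_xxzAF`, `groundSpace_le_spinZSector_zero_xxzAF`) and is ONE-dimensional:
  **`XXZKT.hasUniqueGroundState_xxzAF`**, packaged with `C_ΛΦ = 0` as `XXZKT.komaTasaki_groundState_unique_and_charge_zero`.
* §4 **the payoff — the Anderson tower for the whole printed range `0 < Δ ≤ 1`**: with uniqueness and `C_ΛΦ = 0` in hand,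
  the tree's KT94 Corollary 2.11 machinery (`lowestEnergyInSector_le_of_lro`, `rotation_one_apply_eq_smul_of_hasUniqueGroundState`,
  planar ground-state LRO `xxzAF_ground_planar_of_ne_x`, Theorem 2.4 `KomaTasaki.theorem_2_4_holds`) gives
  `E_k(M) - E_k(0) ≤ c₃M²/N_k` for `M² ≤ c₂N_k` on all large even tori, `d ≥ 2`, `(d,S) ≠ (2,½)`
  (`XXZKT.xxzAF_andersonTower`, `…_holds` unconditional, `…_eigenstates_holds` with the orthogonal low-lying eigenvectors) —
  the tree's `heisenbergAF_andersonTower{,_holds}` was the case `Δ = 1`; the abstract form from ANY certified planar LRO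
  (`XXZKT.xxzAF_andersonTower_of_lro`) and the two-dimensional spin-½ case on the tree's certified window `0 < Δ ≤ 0.15`
  (`XXZKT.xxzAF_andersonTower_spinHalf_two_holds` — hard-core bosons with nearest-neighbour repulsion in `d = 2`).

Everything is PROVED (standard axioms); no definition, no named fact.  WHAT THIS IS NOT: nothing about `Δ ≤ 0`
(for `Δ < 0` the `S³S³` cross terms are not reflection positive; `Δ = 0`, `S = ½` is the hard-core gas file); nothing
about the infinite-volume ground states (which are NOT unique for `d ≥ 2`: `heisenbergAF_not_hasUniqueGroundState`);
nothing about the Hubbard model.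

## Mathlib / tree search

`rg "HasUniqueGroundState" | rg xxz` (2026-08-29): only `hasUniqueGroundState_heisenbergAF` (`Δ = 1`) and the hard-core
gas (`Δ = 0`, `n = 1`).  REUSED: `Matrix.kroneckerGroundState_charge_eigenvalue_eq_zero`, `HardCoreBoson.mem_groundSpace_conj_transport{,_symm}`,
`HardCoreBoson.mulVec_conj_transport{,_symm}`, `xxzHamiltonian_apply_of_ne` (`HardCoreBosonGroundStateUnique`);
`HardCoreBoson.exists_groundState_annihilated_of_conj_submatrix`, `HardCoreBoson.minEnergyOn_eq_groundEnergy_of_mem`,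
`HardCoreBoson.commute_xxzHamiltonian_totalSpin_two` (`HardCoreBosonHalfFillingOptimal`); `Matrix.liebSchupp_exists_groundState_annihilated`
(`ReflectionSymmetricIceRule`); `exists_productOp_conj_xxzHamiltonian` (`IsingAnisotropicAntiferromagnetPhysicalFrame`);
`xyzRealFieldHamiltonian_eq_submatrix`, `xyzLeftHamiltonian_transpose`, `xyzCrossOp_transpose_eq` (`XYZGroundStateOrderGD`);
`siteSpin_eq_torusLeftEmbed/RightEmbed`, `torusToLeft_*`, `sum_sites_split`, `torusSiteParity_reflectBetweenSites`
(`XYOrderGDProofs`, `QuantumSpinChessboardEstimate`, `HalfFillingGaussianDomination`); `LiebMattis.sector_groundState`,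
`reflTransGen_subtype`, `perronFrobenius_groundState_unique/_smul_pos`, `mul_norm_le_of_unit_bound`, `component_mem`,
`sum_components`, `mulVec_supported_of_commute_totalSpin_two`, `magnetisation_of_weight_card_compl`, Heisenberg matrix
elements (`LiebMattis*`); `evenSublattice`, `torusGraph_isBipartiteWith_evenSublattice`, `card_compl_evenSublattice`,
`torusGraph_connected_of_proj` (`TorusBipartite`); KT94 tower machinery (`AndersonTowerOfStates{,Unconditional}`).

## References

* [KomaTasaki1994] T. Koma, H. Tasaki, J. Stat. Phys. **76** (1994) 745–803, §3.2 (3.2)–(3.3) (uniqueness and `C_ΛΦ = 0`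
  «rigorously known»), Theorem 2.4, Corollary 2.11.
* [AizenmanEtAl2004] M. Aizenman, E. H. Lieb, R. Seiringer, J. P. Solovej, J. Yngvason, Phys. Rev. A **70** (2004) 023612,
  Appendix A (uniqueness of the ground state at half filling: Perron–Frobenius + reflection positivity).
* [LiebMattis1962] E. Lieb, D. Mattis, J. Math. Phys. **3** (1962) 749, Theorem 2 and its proof (Perron–Frobenius in the
  sectors; W. Marshall, Proc. Roy. Soc. A 232 (1955) 48; I. Affleck, E. H. Lieb, Lett. Math. Phys. 12 (1986) 57).
* [DLS1978] F. J. Dyson, E. H. Lieb, B. Simon, J. Stat. Phys. **18** (1978) 335, §2 (sublattice rotation, reflections in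
  planes between sites), Lemma 4.1.
* [Tasaki2019Tower] H. Tasaki, J. Stat. Phys. **174** (2019) 735–761, Theorem 3.1, Corollary 3.2.
* [Tasaki2020] H. Tasaki, *Physics and Mathematics of Quantum Many-Body Systems*, §2.4 Theorem 2.3, §2.5, §4.1.
-/

noncomputable section

open Matrix Complex Finset Literature.Probability.LatticeModels
open scoped Kronecker

namespace Literature.MathematicalPhysics.QuantumLattice

/-! ### §1 Perron–Frobenius in the magnetisation sectors of the XXZ antiferromagnet (Marshall–Lieb–Mattis) -/

namespace LiebMattis

section QLattice

variable {Λ : Type*} [Fintype Λ] [DecidableEq Λ] (n : ℕ) (G : SimpleGraph Λ) [DecidableRel G.Adj] (J Δ : ℝ)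

/-- Transfer of a chain along a relation to a second relation that agrees with it off the
diagonal (reflexive steps are dropped). [folklore] -/
private theorem reflTransGen_of_ne_imp' {α : Type*} {r r' : α → α → Prop}
    (h : ∀ a b, a ≠ b → r a b → r' a b) {s t : α} (hst : Relation.ReflTransGen r s t) :
    Relation.ReflTransGen r' s t := by
  induction hst with
  | refl => exact Relation.ReflTransGen.refl
  | @tail b c _ hbc ih =>
    by_cases hbc' : b = c
    · subst hbc'; exact ih
    · exact ih.tail (h _ _ hbc' hbc)

/-- **`Sᶻ`-conservation of the XXZ Hamiltonian in the occupation basis**: matrix elements between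
configurations of different weight vanish. [cite: Tasaki2020, §2.5 eq. (2.5.2)] -/
theorem xxzHamiltonian_apply_eq_zero_of_weight_ne {σ τ : TensorIndex Λ (n + 1)}
    (h : (∑ x, (σ x : ℕ)) ≠ ∑ x, (τ x : ℕ)) : xxzHamiltonian n G J Δ σ τ = 0 := by
  have hστ : σ ≠ τ := fun e => h (by rw [e])
  rw [xxzHamiltonian_apply_of_ne n G J Δ hστ]
  exact heisenbergHamiltonian_apply_eq_zero_of_weight_ne n G J h

/-- The XXZ Hamiltonian is a symmetric matrix in the occupation basis (off the diagonal it is the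
Heisenberg matrix). [cite: Tasaki2020, §2.4 (remarks after eq. (2.4.1))] -/
theorem xxzHamiltonian_apply_comm (σ τ : TensorIndex Λ (n + 1)) :
    xxzHamiltonian n G J Δ σ τ = xxzHamiltonian n G J Δ τ σ := by
  by_cases hστ : σ = τ
  · rw [hστ]
  · rw [xxzHamiltonian_apply_of_ne n G J Δ hστ, xxzHamiltonian_apply_of_ne n G J Δ (Ne.symm hστ),
      heisenbergHamiltonian_apply_comm n G J σ τ]

/-- The XXZ Hamiltonian is a real matrix in the occupation basis. [cite: Tasaki2020, §2.4 (remarks after eq. (2.4.1))] -/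
theorem star_xxzHamiltonian_apply (σ τ : TensorIndex Λ (n + 1)) :
    star (xxzHamiltonian n G J Δ σ τ) = xxzHamiltonian n G J Δ σ τ := by
  rw [(xxzHamiltonian_isHermitian n G J Δ).apply τ σ, xxzHamiltonian_apply_comm n G J Δ τ σ]

/-- **Marshall's sign rule for the XXZ antiferromagnet**: after the Marshall conjugation the off-diagonal
matrix elements are `≤ 0` (they are those of the Heisenberg antiferromagnet). [cite: Tasaki2020, §2.4 Theorem 2.3 (proof)]
[cite: LiebMattis1962, Theorem 2 (proof)] -/
theorem re_marshall_xxzHamiltonian_marshall_nonpos (A : Finset Λ) (hA : G.IsBipartiteWith (A : Set Λ) (↑A)ᶜ)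
    (hJ : 0 ≤ J) {σ τ : TensorIndex Λ (n + 1)} (hστ : σ ≠ τ) :
    (marshallSign A σ * xxzHamiltonian n G J Δ σ τ * marshallSign A τ).re ≤ 0 := by
  rw [xxzHamiltonian_apply_of_ne n G J Δ hστ]
  exact re_marshall_heisenbergHamiltonian_marshall_nonpos n G J A hA hJ hστ

/-- **THE MARSHALL–LIEB–MATTIS SECTOR THEOREM FOR THE XXZ ANTIFERROMAGNET (Perron–Frobenius in a magnetisation
sector).** For the spin-`n/2` XXZ Hamiltonian `J Σ (SˣSˣ + SʸSʸ + Δ SᶻSᶻ)`, `J > 0`, ANY real anisotropy `Δ`, on a finite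
connected graph bipartite in `A`, `Aᶜ`, and a nonempty weight sector `W` (magnetisation `M = |Λ| n/2 - W`):
(1) the sector energy `E(M) = lowestEnergyInSector` is attained at an eigenvector of `H` in the sector; (2) it bounds
the Rayleigh quotient on the sector from below; (3) eigenvectors of `H` at `E(M)` in the sector are unique up to
scalars; (4) a nonzero one satisfies Marshall's sign rule `c (-1)^{Σ_{x∈A} σ_x} ψ(σ) > 0` on the sector.  The proof is
the tree's `LiebMattis.sector_perronFrobenius` verbatim: the anisotropy changes only the (real) DIAGONAL of the matrix
in the occupation basis (`xxzHamiltonian_apply_of_ne`), so the Marshall-conjugated compression is again a real symmetric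
matrix with non-positive off-diagonal entries and the same (ergodic) zero pattern off the diagonal.
[cite: LiebMattis1962, Theorem 2 (proof)] [cite: KomaTasaki1994, §3.2 (claim after (3.2): "rigorously known [Marshall, LiebMattis, AffleckLieb] to be unique")]
[cite: Tasaki2020, §2.4 Theorem 2.3] -/
theorem xxz_sector_perronFrobenius (A : Finset Λ) (hG : G.Connected)
    (hA : G.IsBipartiteWith (A : Set Λ) (↑A)ᶜ) (hJ : 0 < J) (W : ℕ)
    (hW : ∃ σ : TensorIndex Λ (n + 1), (∑ z, (σ z : ℕ)) = W) :
    (∃ ψ ∈ spinZSector (Λ := Λ) n (((Fintype.card Λ * n : ℕ) : ℝ) / 2 - W), ψ ≠ 0 ∧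
      xxzHamiltonian n G J Δ *ᵥ ψ =
        ((lowestEnergyInSector n (xxzHamiltonian n G J Δ)
          (((Fintype.card Λ * n : ℕ) : ℝ) / 2 - W) : ℝ) : ℂ) • ψ) ∧
    (∀ φ ∈ spinZSector (Λ := Λ) n (((Fintype.card Λ * n : ℕ) : ℝ) / 2 - W), star φ ⬝ᵥ φ = 1 →
      lowestEnergyInSector n (xxzHamiltonian n G J Δ)
        (((Fintype.card Λ * n : ℕ) : ℝ) / 2 - W) ≤
        (star φ ⬝ᵥ xxzHamiltonian n G J Δ *ᵥ φ).re) ∧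
    (∀ ψ φ : TensorIndex Λ (n + 1) → ℂ,
      ψ ∈ spinZSector (Λ := Λ) n (((Fintype.card Λ * n : ℕ) : ℝ) / 2 - W) →
      φ ∈ spinZSector (Λ := Λ) n (((Fintype.card Λ * n : ℕ) : ℝ) / 2 - W) →
      xxzHamiltonian n G J Δ *ᵥ ψ =
        ((lowestEnergyInSector n (xxzHamiltonian n G J Δ)
          (((Fintype.card Λ * n : ℕ) : ℝ) / 2 - W) : ℝ) : ℂ) • ψ →
      xxzHamiltonian n G J Δ *ᵥ φ =
        ((lowestEnergyInSector n (xxzHamiltonian n G J Δ)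
          (((Fintype.card Λ * n : ℕ) : ℝ) / 2 - W) : ℝ) : ℂ) • φ →
      ψ ≠ 0 → ∃ c : ℂ, φ = c • ψ) ∧
    (∀ ψ : TensorIndex Λ (n + 1) → ℂ,
      ψ ∈ spinZSector (Λ := Λ) n (((Fintype.card Λ * n : ℕ) : ℝ) / 2 - W) →
      xxzHamiltonian n G J Δ *ᵥ ψ =
        ((lowestEnergyInSector n (xxzHamiltonian n G J Δ)
          (((Fintype.card Λ * n : ℕ) : ℝ) / 2 - W) : ℝ) : ℂ) • ψ →
      ψ ≠ 0 → ∃ c : ℂ, c ≠ 0 ∧ ∀ σ : TensorIndex Λ (n + 1), (∑ z, (σ z : ℕ)) = W →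
        0 < (c * marshallSign A σ * ψ σ).re ∧ (c * marshallSign A σ * ψ σ).im = 0) := by
  set Hx := xxzHamiltonian n G J Δ with hHxdef
  set M : ℝ := ((Fintype.card Λ * n : ℕ) : ℝ) / 2 - W with hMdef
  set K := spinZSector (Λ := Λ) n M with hKdef
  set E : ℝ := lowestEnergyInSector n Hx M with hEdef
  have hH : Hx.IsHermitian := xxzHamiltonian_isHermitian n G J Δ
  have hK : ∀ v, v ∈ K ↔ ∀ σ, ¬(∑ z, (σ z : ℕ)) = W → v σ = 0 :=
    fun v => mem_spinZSector_weight_iff n W v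
  have hinv : ∀ σ τ : TensorIndex Λ (n + 1), ¬(∑ z, (σ z : ℕ)) = W → (∑ z, (τ z : ℕ)) = W →
      Hx σ τ = 0 := fun σ τ hσ hτ =>
    xxzHamiltonian_apply_eq_zero_of_weight_ne n G J Δ (by rw [hτ]; exact hσ)
  -- (1), (2): spectral theory in the invariant coordinate sector
  obtain ⟨h1, h2⟩ := sector_groundState Hx hH (fun σ => (∑ z, (σ z : ℕ)) = W) hW hinv K hK
  have hE : Hx.minEnergyOn K = E := rfl
  rw [hE] at h1 h2
  -- the Marshall-conjugated compression of `Hx` to the sector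
  set ι := {σ : TensorIndex Λ (n + 1) // (∑ z, (σ z : ℕ)) = W}
  set B : Matrix ι ι ℂ :=
    Matrix.of fun s t => marshallSign A s.1 * Hx s.1 t.1 * marshallSign A t.1 with hBdef
  have hBapply : ∀ s t : ι, B s t = marshallSign A s.1 * Hx s.1 t.1 * marshallSign A t.1 :=
    fun s t => rfl
  have hreal : ∀ s t : ι, star (B s t) = B s t := by
    intro s t
    rw [hBapply, star_mul', star_mul', star_marshallSign, star_marshallSign, hHxdef,
      star_xxzHamiltonian_apply]
  have hsymm : ∀ s t : ι, B s t = B t s := by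
    intro s t
    rw [hBapply, hBapply, hHxdef, xxzHamiltonian_apply_comm n G J Δ s.1 t.1]
    ring
  have hoff : ∀ s t : ι, s ≠ t → (B s t).re ≤ 0 := by
    intro s t hst
    rw [hBapply]
    exact re_marshall_xxzHamiltonian_marshall_nonpos n G J Δ A hA hJ.le (fun h => hst (Subtype.ext h))
  -- ergodicity: the off-diagonal zero pattern is that of the Heisenberg antiferromagnet
  have hconn : ∀ s t : ι, Relation.ReflTransGen (fun a b => B a b ≠ 0) s t := by
    intro s t
    have h0 : Relation.ReflTransGen (fun a b : ι =>
        marshallSign A a.1 * heisenbergHamiltonian n G J a.1 b.1 * marshallSign A b.1 ≠ 0) s t := by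
      refine reflTransGen_subtype n G J hG hJ W (B := Matrix.of fun a b : ι =>
        marshallSign A a.1 * heisenbergHamiltonian n G J a.1 b.1 * marshallSign A b.1) (fun a b hab => ?_) s t
      rw [Matrix.of_apply]
      refine mul_ne_zero (mul_ne_zero ?_ hab) ?_
      · rcases marshallSign_eq_or A a.1 with h | h <;> rw [h] <;> norm_num
      · rcases marshallSign_eq_or A b.1 with h | h <;> rw [h] <;> norm_num
    refine reflTransGen_of_ne_imp' (fun a b hab h => ?_) h0
    rw [hBapply, hHxdef, xxzHamiltonian_apply_of_ne n G J Δ (fun h' => hab (Subtype.ext h'))]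
    exact h
  -- extension by zero with Marshall signs, and restriction
  have hext_mem : ∀ v : ι → ℂ,
      (fun σ => if h : (∑ z, (σ z : ℕ)) = W then marshallSign A σ * v ⟨σ, h⟩ else 0) ∈ K := by
    intro v
    rw [hK]
    intro σ hσ
    rw [dif_neg hσ]
  have hdot : ∀ (v : ι → ℂ) (w : TensorIndex Λ (n + 1) → ℂ),
      star (fun σ => if h : (∑ z, (σ z : ℕ)) = W then marshallSign A σ * v ⟨σ, h⟩ else 0) ⬝ᵥ w =
        star v ⬝ᵥ fun s => marshallSign A s.1 * w s.1 := by
    intro v w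
    rw [dotProduct, dotProduct, sum_eq_sum_subtype_of_support (fun σ => (∑ z, (σ z : ℕ)) = W)]
    · refine Finset.sum_congr rfl fun s _ => ?_
      rw [Pi.star_apply, Pi.star_apply, dif_pos s.2, star_mul', star_marshallSign]
      ring
    · intro σ hσ
      rw [Pi.star_apply, dif_neg hσ, star_zero, zero_mul]
  have hHext : ∀ (v : ι → ℂ) (s : ι),
      (Hx *ᵥ fun σ => if h : (∑ z, (σ z : ℕ)) = W then marshallSign A σ * v ⟨σ, h⟩ else 0) s.1 =
        marshallSign A s.1 * (B *ᵥ v) s := by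
    intro v s
    rw [mulVec, dotProduct, mulVec, dotProduct, Finset.mul_sum,
      sum_eq_sum_subtype_of_support (fun σ => (∑ z, (σ z : ℕ)) = W)]
    · refine Finset.sum_congr rfl fun t _ => ?_
      rw [dif_pos t.2, hBapply, Subtype.coe_eta]
      have hm := marshallSign_mul_self A s.1
      linear_combination -(Hx s.1 t.1 * marshallSign A t.1 * v t) * hm
    · intro τ hτ
      rw [dif_neg hτ, mul_zero]
  have hEB : ∀ v : ι → ℂ, E * (star v ⬝ᵥ v).re ≤ (star v ⬝ᵥ B *ᵥ v).re := by
    intro v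
    set φ : TensorIndex Λ (n + 1) → ℂ :=
      fun σ => if h : (∑ z, (σ z : ℕ)) = W then marshallSign A σ * v ⟨σ, h⟩ else 0 with hφdef
    have hφφ : star φ ⬝ᵥ φ = star v ⬝ᵥ v := by
      rw [hφdef, hdot]
      congr 1
      funext s
      rw [dif_pos s.2, ← mul_assoc, marshallSign_mul_self, one_mul]
    have hφH : star φ ⬝ᵥ Hx *ᵥ φ = star v ⬝ᵥ B *ᵥ v := by
      rw [hφdef, hdot]
      congr 1
      funext s
      rw [hHext, ← mul_assoc, marshallSign_mul_self, one_mul]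
    have := mul_norm_le_of_unit_bound n Hx K h2 (hext_mem v)
    rw [hφφ, hφH] at this
    exact this
  -- restriction of sector eigenvectors
  have hres : ∀ ψ : TensorIndex Λ (n + 1) → ℂ, ψ ∈ K → Hx *ᵥ ψ = (E : ℂ) • ψ →
      B *ᵥ (fun s : ι => marshallSign A s.1 * ψ s.1) =
        (E : ℂ) • fun s : ι => marshallSign A s.1 * ψ s.1 := by
    intro ψ hψ hHψ
    funext s
    rw [Pi.smul_apply, smul_eq_mul, mulVec, dotProduct]
    have h := congrFun hHψ s.1
    rw [Pi.smul_apply, smul_eq_mul, mulVec, dotProduct,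
      sum_eq_sum_subtype_of_support (fun σ => (∑ z, (σ z : ℕ)) = W)] at h
    · calc ∑ t : ι, B s t * (marshallSign A t.1 * ψ t.1)
          = marshallSign A s.1 * ∑ t : ι, Hx s.1 t.1 * ψ t.1 := by
            rw [Finset.mul_sum]
            refine Finset.sum_congr rfl fun t _ => ?_
            rw [hBapply]
            have hm := marshallSign_mul_self A t.1
            linear_combination (marshallSign A s.1 * Hx s.1 t.1 * ψ t.1) * hm
        _ = (E : ℂ) * (marshallSign A s.1 * ψ s.1) := by rw [h]; ring
    · intro τ hτ
      rw [(hK ψ).1 hψ τ hτ, mul_zero]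
  have hres0 : ∀ ψ : TensorIndex Λ (n + 1) → ℂ, ψ ∈ K → ψ ≠ 0 →
      (fun s : ι => marshallSign A s.1 * ψ s.1) ≠ 0 := by
    intro ψ hψ hψ0 h
    apply hψ0
    funext σ
    by_cases hσ : (∑ z, (σ z : ℕ)) = W
    · have h1 := congrFun h ⟨σ, hσ⟩
      simp only [Pi.zero_apply, mul_eq_zero] at h1
      rcases h1 with h1 | h1
      · rcases marshallSign_eq_or A σ with h2 | h2 <;> rw [h2] at h1 <;> norm_num at h1
      · exact h1
    · exact (hK ψ).1 hψ σ hσ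
  refine ⟨h1, h2, ?_, ?_⟩
  · -- (3) uniqueness
    intro ψ φ hψ hφ hHψ hHφ hψ0
    obtain ⟨c, hc⟩ := perronFrobenius_groundState_unique hsymm hreal hoff hconn hEB
      (hres ψ hψ hHψ) (hres φ hφ hHφ) (hres0 ψ hψ hψ0)
    refine ⟨c, funext fun σ => ?_⟩
    by_cases hσ : (∑ z, (σ z : ℕ)) = W
    · have h := congrFun hc ⟨σ, hσ⟩
      simp only [Pi.smul_apply, smul_eq_mul] at h
      have hm := marshallSign_mul_self A σ
      rw [Pi.smul_apply, smul_eq_mul]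
      linear_combination marshallSign A σ * h - (φ σ - c * ψ σ) * hm
    · rw [Pi.smul_apply, smul_eq_mul, (hK ψ).1 hψ σ hσ, (hK φ).1 hφ σ hσ, mul_zero]
  · -- (4) positivity (Marshall sign rule)
    intro ψ hψ hHψ hψ0
    obtain ⟨c, hc0, hc⟩ := perronFrobenius_groundState_smul_pos hsymm hreal hoff hconn hEB
      (hres ψ hψ hHψ) (hres0 ψ hψ hψ0)
    refine ⟨c, hc0, fun σ hσ => ?_⟩
    have h := hc ⟨σ, hσ⟩
    rw [← mul_assoc] at h
    exact h

/-- **`H` is block diagonal**: the weight components of an eigenvector of the XXZ Hamiltonian are eigenvectors (or zero)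
with the same eigenvalue (`Sᶻ`-conservation). [cite: Tasaki2020, §2.5 eq. (2.5.2)] -/
theorem xxzHamiltonian_mulVec_component {Φ : TensorIndex Λ (n + 1) → ℂ} {μ : ℂ}
    (h : xxzHamiltonian n G J Δ *ᵥ Φ = μ • Φ) (W : ℕ) :
    xxzHamiltonian n G J Δ *ᵥ (fun σ => if (∑ z, (σ z : ℕ)) = W then Φ σ else 0) =
      μ • fun σ => if (∑ z, (σ z : ℕ)) = W then Φ σ else 0 := by
  funext σ
  rw [Pi.smul_apply, smul_eq_mul]
  by_cases hσ : (∑ z, (σ z : ℕ)) = W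
  · rw [if_pos hσ]
    have h1 := congrFun h σ
    rw [Pi.smul_apply, smul_eq_mul] at h1
    rw [← h1, mulVec, mulVec, dotProduct, dotProduct]
    refine Finset.sum_congr rfl fun τ _ => ?_
    by_cases hτ : (∑ z, (τ z : ℕ)) = W
    · rw [if_pos hτ]
    · rw [if_neg hτ, xxzHamiltonian_apply_eq_zero_of_weight_ne n G J Δ (by rw [hσ]; exact Ne.symm hτ),
        zero_mul, zero_mul]
  · rw [if_neg hσ, mul_zero]
    exact mulVec_supported_of_commute_totalSpin_two n
      (HardCoreBoson.commute_xxzHamiltonian_totalSpin_two n G J Δ) (W := W) (fun τ hτ => if_neg hτ) σ hσ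

end QLattice

end LiebMattis

/-! ### §2 The reflection-positive Kronecker picture of the XXZ antiferromagnet along a pair of planes
(Dyson–Lieb–Simon / Kennedy–Lieb–Shastry), and the staggered charge -/

namespace XXZKT

section Kronecker

variable {d : ℕ} (L : ℕ) [NeZero L]

omit [NeZero L] in
/-- Reindexing is additive (pointwise form of `Matrix.submatrix_add`). [folklore] -/
private theorem submatrix_add_pt {p q : Type*} (A B : Matrix q q ℂ) (e : p → q) :
    (A + B).submatrix e e = A.submatrix e e + B.submatrix e e := rfl

omit [NeZero L] in
/-- Reindexing commutes with scalars (pointwise form of `Matrix.submatrix_smul`). [folklore] -/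
private theorem submatrix_smul_pt {p q : Type*} (c : ℂ) (A : Matrix q q ℂ) (e : p → q) :
    (c • A).submatrix e e = c • A.submatrix e e := rfl

omit [NeZero L] in
/-- Rescaling a reflection-symmetric Kronecker form by `c = r² ≥ 0` keeps its shape:
`c·(A ⊗ 1 + 1 ⊗ A - Σᵢ Mᵢ ⊗ Mᵢ) = (cA) ⊗ 1 + 1 ⊗ (cA) - Σᵢ (rMᵢ) ⊗ (rMᵢ)`. [folklore] -/
private theorem smul_kroneckerForm {p ι : Type*} [Fintype ι] [Fintype p] [DecidableEq p]
    (A : Matrix p p ℂ) (M : ι → Matrix p p ℂ) {c r : ℝ} (hr : r ^ 2 = c) :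
    (c : ℂ) • (A ⊗ₖ (1 : Matrix p p ℂ) + (1 : Matrix p p ℂ) ⊗ₖ A - ∑ i, M i ⊗ₖ M i) =
      ((c : ℂ) • A) ⊗ₖ (1 : Matrix p p ℂ) + (1 : Matrix p p ℂ) ⊗ₖ ((c : ℂ) • A) -
        ∑ i, ((r : ℂ) • M i) ⊗ₖ ((r : ℂ) • M i) := by
  have hrr : (r : ℂ) * (r : ℂ) = (c : ℂ) := by rw [← Complex.ofReal_mul, ← sq, hr]
  simp only [Matrix.smul_kronecker, Matrix.kronecker_smul, smul_sub, smul_add, Finset.smul_sum, smul_smul, hrr]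

/-- **The staggered magnetisation is `F_ε ⊗ 1 - 1 ⊗ F_ε`** along the planes `xⱼ = a + ½`, `xⱼ = a + ½ + L/2`
(the reflection exchanges the two sublattices, `torusSiteParity_reflectBetweenSites`): the two-sided charge
`S' = X ⊗ 1 - 1 ⊗ X` of Aizenman–Lieb–Seiringer–Solovej–Yngvason's Appendix A, for every spin `n/2`
(the tree's `HardCoreBoson.stagSpin_eq_submatrix` is the case `n = 1`). [cite: AizenmanEtAl2004, Appendix A] -/
theorem stagCharge_eq_submatrix (hL : Even L) (j : Fin d) (a : ZMod L) (n : ℕ) :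
    (∑ x : TorusSite d L,
        (((if torusSiteParity L hL x = 0 then (1 : ℝ) else -1 : ℝ)) : ℂ) • siteSpin n x 2) =
      ((∑ t : torusLeftHalf L j a,
            (((if torusSiteParity L hL (t : TorusSite d L) = 0 then (1 : ℝ) else -1 : ℝ)) : ℂ) •
              siteSpin n t 2) ⊗ₖ (1 : Op (torusLeftHalf L j a) (n + 1)) +
        (1 : Op (torusLeftHalf L j a) (n + 1)) ⊗ₖ
          (-(∑ t : torusLeftHalf L j a,
            (((if torusSiteParity L hL (t : TorusSite d L) = 0 then (1 : ℝ) else -1 : ℝ)) : ℂ) •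
              siteSpin n t 2))).submatrix (torusSplit L j a hL) (torusSplit L j a hL) := by
  have h01 : ∀ t : ZMod 2, t = 0 ∨ t = 1 := by decide
  rw [sum_sites_split L j a hL, submatrix_add_pt, ← torusLeftEmbed_apply, ← torusRightEmbed_apply,
    map_neg, map_sum, map_sum, ← Finset.sum_coe_sort (torusLeftHalf L j a),
    ← Finset.sum_coe_sort (torusLeftHalf L j a), ← Finset.sum_neg_distrib]
  congr 1
  · refine Finset.sum_congr rfl fun t _ => ?_
    rw [map_smul, siteSpin_eq_torusLeftEmbed (hL := hL) n t.2, torusToLeft_of_mem L j a hL t.2]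
  · refine Finset.sum_congr rfl fun t _ => ?_
    have ht' : Torus.reflectBetweenSites j a (t : TorusSite d L) ∉ torusLeftHalf L j a := fun h =>
      (reflectBetweenSites_mem_torusLeftHalf_iff L j a hL (t : TorusSite d L)).1 h t.2
    rw [map_smul, siteSpin_eq_torusRightEmbed (hL := hL) n ht', torusToLeft_reflectBetweenSites,
      torusToLeft_of_mem L j a hL t.2, torusSiteParity_reflectBetweenSites L hL j a, ← neg_smul]
    congr 1
    rcases h01 (torusSiteParity L hL (t : TorusSite d L)) with h0 | h1
    · rw [h0, if_neg (show ¬ ((0 : ZMod 2) + 1 = 0) by decide), if_pos rfl]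
      push_cast
      ring
    · rw [h1, if_pos (show (1 : ZMod 2) + 1 = 0 by decide), if_neg (show ¬ ((1 : ZMod 2) = 0) by decide)]
      push_cast
      ring

/-- The left staggered magnetisation `F_ε = Σ_{t ∈ Λ_L} ε_t S³_t` is a real symmetric (hence Hermitian) matrix.
[cite: AizenmanEtAl2004, Appendix A] -/
theorem stagChargeLeft_transpose (hL : Even L) (j : Fin d) (a : ZMod L) (n : ℕ) :
    (∑ t : torusLeftHalf L j a,
        (((if torusSiteParity L hL (t : TorusSite d L) = 0 then (1 : ℝ) else -1 : ℝ)) : ℂ) •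
          siteSpin n t 2 : Op (torusLeftHalf L j a) (n + 1))ᵀ =
      ∑ t : torusLeftHalf L j a,
        (((if torusSiteParity L hL (t : TorusSite d L) = 0 then (1 : ℝ) else -1 : ℝ)) : ℂ) • siteSpin n t 2 := by
  rw [Matrix.transpose_sum]
  refine Finset.sum_congr rfl fun t _ => ?_
  rw [transpose_smul, siteSpin_two_transpose_eq n t, (siteSpin_isHermitian n t 2).eq]

/-- `F_ε` is Hermitian. [cite: AizenmanEtAl2004, Appendix A] -/
theorem stagChargeLeft_isHermitian (hL : Even L) (j : Fin d) (a : ZMod L) (n : ℕ) :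
    (∑ t : torusLeftHalf L j a,
        (((if torusSiteParity L hL (t : TorusSite d L) = 0 then (1 : ℝ) else -1 : ℝ)) : ℂ) •
          siteSpin n t 2 : Op (torusLeftHalf L j a) (n + 1)).IsHermitian := by
  rw [IsHermitian, conjTranspose_sum]
  refine Finset.sum_congr rfl fun t _ => ?_
  rw [conjTranspose_smul, (siteSpin_isHermitian n t 2).eq, Complex.star_def, Complex.conj_ofReal]

end Kronecker

/-! ### §3 The absolute ground state has `Sᶻ_tot = 0` (Aizenman–Lieb–Seiringer–Solovej–Yngvason, Appendix A,
for the XXZ antiferromagnet) -/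

section GroundState

variable {d : ℕ} (L : ℕ) [NeZero L]

omit [NeZero L] in
/-- Round trip `φ ↦ Wᴴ(φ ∘ e) ↦ (W Wᴴ (φ ∘ e)) ∘ e⁻¹ = φ`. [folklore] -/
private theorem conj_transport_roundtrip' {ι p : Type*} [Fintype ι] [DecidableEq ι] {W : Matrix ι ι ℂ} (e : ι ≃ p)
    (hW : W * Wᴴ = 1) (φ : p → ℂ) : (W *ᵥ (Wᴴ *ᵥ (φ ∘ e))) ∘ e.symm = φ := by
  rw [mulVec_mulVec, hW, one_mulVec, Function.comp_assoc, Equiv.self_comp_symm, Function.comp_id]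

/-- **The XXZ antiferromagnet has a ground state with `Sᶻ_tot = 0`** (every spin `n/2`, `J > 0`, `Δ > 0`, even
torus `(ℤ/Lℤ)^d`, `d ≥ 1`).  Proof (ALSSY App. A «we shall use reflection positivity»): the odd-sublattice
half-turn about the `y`-axis (`exists_productOp_conj_xxzHamiltonian`) conjugates `H^{XXZ}_{J,Δ}` into `(JΔ)·H♭`,
`H♭ = -Σ(Δ⁻¹S¹S¹ - Δ⁻¹S²S² + S³S³)` the tree's real rotated form, whose Kennedy–Lieb–Shastry / Björnberg–Ueltschi
Kronecker form along a pair of planes (`xyzRealFieldHamiltonian_eq_submatrix`) is `A ⊗ 1 + 1 ⊗ A - Σᵢ Mᵢ ⊗ Mᵢ`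
with real `A`, `Mᵢ`; the same unitary turns `Sᶻ_tot` into the STAGGERED magnetisation `F_ε ⊗ 1 - 1 ⊗ F_ε`
(`stagCharge_eq_submatrix`).  The Dyson–Lieb–Simon positive ground state `vec c`, `c ⪰ 0`, overlaps `vec 1`, which the
charge annihilates; projecting gives the annihilated ground state (`Matrix.liebSchupp_exists_groundState_annihilated`).
[cite: AizenmanEtAl2004, Appendix A] [cite: KomaTasaki1994, §3.2 (3.3) (`C_Λ Φ = 0`)] [cite: DLS1978, §2, Lemma 4.1] -/
theorem exists_groundState_totalSpin_eq_zero_xxzAF (hd : 0 < d) (hL : Even L) (n : ℕ) {J Δ : ℝ} (hJ : 0 < J)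
    (hΔ : 0 < Δ) :
    ∃ ψ : TensorIndex (TorusSite d L) (n + 1) → ℂ, ψ ≠ 0 ∧
      ψ ∈ (xxzHamiltonian n (torusGraph d L) J Δ).groundSpace ∧ totalSpin n 2 *ᵥ ψ = 0 := by
  obtain ⟨R, hRR, hRR', hRz, hconjR⟩ := exists_productOp_conj_xxzHamiltonian (d := d) L hL n
  set ε : TorusSite d L → ZMod 2 := torusSiteParity L hL with hε
  set u : TorusSite d L → Matrix (Fin (n + 1)) (Fin (n + 1)) ℂ :=
    fun z => if ε z = 0 then 1 else R with hu
  have hua : ∀ z, u z * (u z)ᴴ = 1 := by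
    intro z; simp only [hu]; split_ifs
    · rw [conjTranspose_one, Matrix.mul_one]
    · exact hRR
  have hub : ∀ z, (u z)ᴴ * u z = 1 := by
    intro z; simp only [hu]; split_ifs
    · rw [conjTranspose_one, Matrix.mul_one]
    · exact hRR'
  set U : Op (TorusSite d L) (n + 1) := productOp u with hUdef
  have hU : U * Uᴴ = 1 := productOp_mul_conjTranspose hua
  have hU' : Uᴴ * U = 1 := productOp_conjTranspose_mul hub
  set j : Fin d := ⟨0, hd⟩ with hj
  set a : ZMod L := 0 with ha
  set e := torusSplit (q := n + 1) L j a hL with he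
  set s : ℝ := Real.sqrt Δ⁻¹ with hs
  have hs2 : s ^ 2 = Δ⁻¹ := Real.sq_sqrt (inv_nonneg.2 hΔ.le)
  set c : ℝ := J * Δ with hc
  have hc0 : 0 < c := mul_pos hJ hΔ
  set r : ℝ := Real.sqrt c with hr
  have hr2 : r ^ 2 = c := Real.sq_sqrt hc0.le
  set A₀ := xyzLeftHamiltonian L j a hL n (s ^ 2) (-(s ^ 2)) 0 with hA₀
  set M₀ := xyzCrossOp L j a hL n s s 0 with hM₀
  set A : Op (torusLeftHalf L j a) (n + 1) := (c : ℂ) • A₀ with hA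
  set M : torusCrossSites L j a × Fin 3 → Op (torusLeftHalf L j a) (n + 1) := fun i => (r : ℂ) • M₀ i with hM
  set Fs : Op (torusLeftHalf L j a) (n + 1) := ∑ t : torusLeftHalf L j a,
    (((if torusSiteParity L hL (t : TorusSite d L) = 0 then (1 : ℝ) else -1 : ℝ)) : ℂ) • siteSpin n t 2 with hFs
  -- the conjugated Hamiltonian in Kronecker form
  have hK₀ : xyzRealFieldHamiltonian L n (s ^ 2) (-(s ^ 2)) (0 : TorusSite d L → ℝ) =
      (A₀ ⊗ₖ (1 : Op (torusLeftHalf L j a) (n + 1)) + (1 : Op (torusLeftHalf L j a) (n + 1)) ⊗ₖ A₀ -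
        ∑ i, M₀ i ⊗ₖ M₀ i).submatrix e e :=
    xyzRealFieldHamiltonian_eq_submatrix L j a hL n s s 0
  have hconj : U * xxzHamiltonian n (torusGraph d L) J Δ * Uᴴ =
      (A ⊗ₖ (1 : Op (torusLeftHalf L j a) (n + 1)) + (1 : Op (torusLeftHalf L j a) (n + 1)) ⊗ₖ A -
        ∑ i, M i ⊗ₖ M i).submatrix e e := by
    rw [hUdef, hconjR J Δ hΔ.ne', ← hs2, hK₀, ← submatrix_smul_pt, smul_kroneckerForm A₀ M₀ hr2]
  -- the conjugated charge
  have hUz : ∀ x : TorusSite d L, U * siteSpin n x 2 * Uᴴ =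
      (((if torusSiteParity L hL x = 0 then (1 : ℝ) else -1 : ℝ)) : ℂ) • siteSpin n x 2 := by
    intro x
    rw [hUdef, siteSpin, productOp_conj_onSite hua, ← onSite_smul']
    congr 1
    simp only [hu, hε]
    split_ifs with hx
    · rw [conjTranspose_one, Matrix.mul_one, Matrix.one_mul]
      push_cast
      rw [one_smul]
    · rw [spinVec_two, hRz]
      push_cast
      rw [neg_one_smul]
  have hconjS : U * totalSpin n 2 * Uᴴ =
      (Fs ⊗ₖ (1 : Op (torusLeftHalf L j a) (n + 1)) +
        (1 : Op (torusLeftHalf L j a) (n + 1)) ⊗ₖ (-Fs)).submatrix e e := by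
    rw [totalSpin, Finset.mul_sum, Finset.sum_mul, Finset.sum_congr rfl fun x _ => hUz x]
    exact stagCharge_eq_submatrix L hL j a n
  -- Hermiticity of the Kronecker form
  have hH := xxzHamiltonian_isHermitian n (torusGraph d L) J Δ
  have hK : (A ⊗ₖ (1 : Op (torusLeftHalf L j a) (n + 1)) + (1 : Op (torusLeftHalf L j a) (n + 1)) ⊗ₖ A -
      ∑ i, M i ⊗ₖ M i).IsHermitian := by
    have h := (Matrix.isHermitian_mul_mul_conjTranspose U hH).submatrix e.symm
    rw [hconj, submatrix_submatrix, Equiv.self_comp_symm, submatrix_id_id] at h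
    exact h
  -- commutation in Kronecker coordinates
  have hprod : ∀ X Y : Op (TorusSite d L) (n + 1), U * (X * Y) * Uᴴ = U * X * Uᴴ * (U * Y * Uᴴ) := by
    intro X Y
    calc U * (X * Y) * Uᴴ = U * (X * (Uᴴ * U) * Y) * Uᴴ := by rw [hU', Matrix.mul_one]
      _ = U * X * Uᴴ * (U * Y * Uᴴ) := by simp only [Matrix.mul_assoc]
  have eq_of_sub : ∀ {X Y : Matrix ((torusLeftHalf L j a → Fin (n + 1)) × (torusLeftHalf L j a → Fin (n + 1)))
      ((torusLeftHalf L j a → Fin (n + 1)) × (torusLeftHalf L j a → Fin (n + 1))) ℂ},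
      X.submatrix e e = Y.submatrix e e → X = Y := by
    intro X Y h
    have h' := congrArg (fun Z : Op (TorusSite d L) (n + 1) => Z.submatrix e.symm e.symm) h
    simpa only [submatrix_submatrix, Equiv.self_comp_symm, submatrix_id_id] using h'
  have hcomm : (Fs ⊗ₖ (1 : Op (torusLeftHalf L j a) (n + 1)) + (1 : Op (torusLeftHalf L j a) (n + 1)) ⊗ₖ (-Fs)) *
      (A ⊗ₖ (1 : Op (torusLeftHalf L j a) (n + 1)) + (1 : Op (torusLeftHalf L j a) (n + 1)) ⊗ₖ A -
        ∑ i, M i ⊗ₖ M i) =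
      (A ⊗ₖ (1 : Op (torusLeftHalf L j a) (n + 1)) + (1 : Op (torusLeftHalf L j a) (n + 1)) ⊗ₖ A -
        ∑ i, M i ⊗ₖ M i) *
      (Fs ⊗ₖ (1 : Op (torusLeftHalf L j a) (n + 1)) + (1 : Op (torusLeftHalf L j a) (n + 1)) ⊗ₖ (-Fs)) := by
    refine eq_of_sub ?_
    rw [← submatrix_mul_equiv (e₂ := e), ← submatrix_mul_equiv (e₂ := e), ← hconj, ← hconjS, ← hprod,
      ← hprod, (HardCoreBoson.commute_xxzHamiltonian_totalSpin_two n (torusGraph d L) J Δ).symm.eq]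
  -- realness
  have hAt : Aᵀ = A := by
    rw [hA, transpose_smul, hA₀, xyzLeftHamiltonian_transpose]
  have hMt : ∀ i, (M i)ᵀ = (M i)ᴴ := fun i =>
    transpose_eq_conjTranspose_ofReal_smul (xyzCrossOp_transpose_eq L j a n hL s s 0 i) r
  have hFst : Fsᵀ = Fs := by rw [hFs]; exact stagChargeLeft_transpose L hL j a n
  have hXY : ∀ _ : Unit, (-Fs)ᵀ = -Fs := fun _ => by rw [transpose_neg, hFst]
  haveI : Nonempty (torusLeftHalf L j a → Fin (n + 1)) := ⟨fun _ => 0⟩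
  obtain ⟨φ, hφ, hφ0, hQφ⟩ := Matrix.liebSchupp_exists_groundState_annihilated A M hAt hMt hK
    (fun _ : Unit => Fs) (fun _ : Unit => -Fs) hXY (fun _ => hcomm)
  exact HardCoreBoson.exists_groundState_annihilated_of_conj_submatrix e hK hU hU' hconj hconjS hφ hφ0 (hQφ ())

/-- **The sector `Sᶻ_tot = 0` realises the ground energy** of the XXZ antiferromagnet on the even torus
(`J > 0`, `Δ > 0`, every spin). [cite: AizenmanEtAl2004, Appendix A] [cite: KomaTasaki1994, §3.2 (3.3)] -/
theorem lowestEnergyInSector_zero_eq_groundEnergy_xxzAF (hd : 0 < d) (hL : Even L) (n : ℕ) {J Δ : ℝ}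
    (hJ : 0 < J) (hΔ : 0 < Δ) :
    lowestEnergyInSector n (xxzHamiltonian n (torusGraph d L) J Δ) 0 =
      (xxzHamiltonian n (torusGraph d L) J Δ).groundEnergy := by
  obtain ⟨ψ, hψ0, hψ, hS⟩ := exists_groundState_totalSpin_eq_zero_xxzAF L hd hL n hJ hΔ
  refine HardCoreBoson.minEnergyOn_eq_groundEnergy_of_mem (xxzHamiltonian_isHermitian n _ J Δ) hψ hψ0 ?_
  rw [spinZSector, Module.End.mem_eigenspace_iff, Matrix.toLin'_apply, hS, Complex.ofReal_zero, zero_smul]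

/-- **Uniqueness in the sector `Sᶻ_tot = 0`** (Perron–Frobenius / Marshall–Lieb–Mattis, `xxz_sector_perronFrobenius`):
two ground states of the XXZ antiferromagnet annihilated by `Sᶻ_tot` are proportional. [cite: AizenmanEtAl2004, Appendix A]
[cite: LiebMattis1962, Theorem 2 (proof)] -/
theorem groundState_totalSpin_zero_unique_xxzAF (hd : 0 < d) (hL : Even L) (n : ℕ) {J Δ : ℝ}
    (hJ : 0 < J) (hΔ : 0 < Δ) {ψ φ : TensorIndex (TorusSite d L) (n + 1) → ℂ}
    (hψ : ψ ∈ (xxzHamiltonian n (torusGraph d L) J Δ).groundSpace)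
    (hφ : φ ∈ (xxzHamiltonian n (torusGraph d L) J Δ).groundSpace) (hSψ : totalSpin n 2 *ᵥ ψ = 0)
    (hSφ : totalSpin n 2 *ᵥ φ = 0) (hψ0 : ψ ≠ 0) : ∃ c : ℂ, φ = c • ψ := by
  have hL2 : 2 ∣ L := even_iff_two_dvd.1 hL
  set Aev := evenSublattice (d := d) L hL2 with hAev
  have hcard := card_compl_evenSublattice (d := d) L hL2 ⟨0, hd⟩
  set W₀ : ℕ := Aevᶜ.card * n with hW₀
  have hM0 : ((Fintype.card (TorusSite d L) * n : ℕ) : ℝ) / 2 - (W₀ : ℝ) = 0 := by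
    have h := LiebMattis.magnetisation_of_weight_card_compl n Aev hcard
    rw [hW₀]
    exact h
  have hsec : ∀ v : TensorIndex (TorusSite d L) (n + 1) → ℂ, totalSpin n 2 *ᵥ v = 0 →
      v ∈ spinZSector (Λ := TorusSite d L) n (((Fintype.card (TorusSite d L) * n : ℕ) : ℝ) / 2 - (W₀ : ℕ)) := by
    intro v hv
    rw [hM0, spinZSector, Module.End.mem_eigenspace_iff, Matrix.toLin'_apply, hv, Complex.ofReal_zero, zero_smul]
  have hψs := hsec ψ hSψ
  have hφs := hsec φ hSφ
  have hW : ∃ σ : TensorIndex (TorusSite d L) (n + 1), (∑ z, (σ z : ℕ)) = W₀ := by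
    by_contra hne
    push Not at hne
    exact hψ0 (funext fun σ => (LiebMattis.mem_spinZSector_weight_iff n W₀ ψ).1 hψs σ (hne σ))
  obtain ⟨-, -, h3, -⟩ := LiebMattis.xxz_sector_perronFrobenius n (torusGraph d L) J Δ Aev
    (torusGraph_connected_of_proj d L) (torusGraph_isBipartiteWith_evenSublattice (d := d) L hL2) hJ W₀ hW
  rw [hM0, lowestEnergyInSector_zero_eq_groundEnergy_xxzAF L hd hL n hJ hΔ] at h3
  rw [hM0] at hψs hφs
  exact h3 ψ φ hψs hφs ((Matrix.mem_groundSpace_iff _ _).1 hψ) ((Matrix.mem_groundSpace_iff _ _).1 hφ) hψ0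

/-- **Every ground state of the XXZ antiferromagnet which is an eigenvector of `Sᶻ_tot` has `Sᶻ_tot = 0`**
(ALSSY App. A: «We claim that the absolute ground state of `H` corresponds to the value `Σ_x S³_x = 0`. To prove this
we shall use reflection positivity» — the polar-decomposition argument `Matrix.kroneckerGroundState_charge_eigenvalue_eq_zero`
in the Kronecker picture of `exists_groundState_totalSpin_eq_zero_xxzAF`, with the uniqueness input
`groundState_totalSpin_zero_unique_xxzAF` transported along the sublattice half-turn). [cite: AizenmanEtAl2004, Appendix A] -/
theorem groundState_totalSpin_eigenvalue_eq_zero_xxzAF (hd : 0 < d) (hL : Even L) (n : ℕ) {J Δ : ℝ}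
    (hJ : 0 < J) (hΔ : 0 < Δ) {ψ : TensorIndex (TorusSite d L) (n + 1) → ℂ}
    (hψ : ψ ∈ (xxzHamiltonian n (torusGraph d L) J Δ).groundSpace) (hψ0 : ψ ≠ 0) {μ : ℂ}
    (hS : totalSpin n 2 *ᵥ ψ = μ • ψ) : μ = 0 := by
  obtain ⟨R, hRR, hRR', hRz, hconjR⟩ := exists_productOp_conj_xxzHamiltonian (d := d) L hL n
  set ε : TorusSite d L → ZMod 2 := torusSiteParity L hL with hε
  set u : TorusSite d L → Matrix (Fin (n + 1)) (Fin (n + 1)) ℂ :=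
    fun z => if ε z = 0 then 1 else R with hu
  have hua : ∀ z, u z * (u z)ᴴ = 1 := by
    intro z; simp only [hu]; split_ifs
    · rw [conjTranspose_one, Matrix.mul_one]
    · exact hRR
  have hub : ∀ z, (u z)ᴴ * u z = 1 := by
    intro z; simp only [hu]; split_ifs
    · rw [conjTranspose_one, Matrix.mul_one]
    · exact hRR'
  set U : Op (TorusSite d L) (n + 1) := productOp u with hUdef
  have hU : U * Uᴴ = 1 := productOp_mul_conjTranspose hua
  have hU' : Uᴴ * U = 1 := productOp_conjTranspose_mul hub
  set j : Fin d := ⟨0, hd⟩ with hj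
  set a : ZMod L := 0 with ha
  set e := torusSplit (q := n + 1) L j a hL with he
  set s : ℝ := Real.sqrt Δ⁻¹ with hs
  have hs2 : s ^ 2 = Δ⁻¹ := Real.sq_sqrt (inv_nonneg.2 hΔ.le)
  set c : ℝ := J * Δ with hc
  have hc0 : 0 < c := mul_pos hJ hΔ
  set r : ℝ := Real.sqrt c with hr
  have hr2 : r ^ 2 = c := Real.sq_sqrt hc0.le
  set A₀ := xyzLeftHamiltonian L j a hL n (s ^ 2) (-(s ^ 2)) 0 with hA₀
  set M₀ := xyzCrossOp L j a hL n s s 0 with hM₀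
  set A : Op (torusLeftHalf L j a) (n + 1) := (c : ℂ) • A₀ with hA
  set M : torusCrossSites L j a × Fin 3 → Op (torusLeftHalf L j a) (n + 1) := fun i => (r : ℂ) • M₀ i with hM
  set Fs : Op (torusLeftHalf L j a) (n + 1) := ∑ t : torusLeftHalf L j a,
    (((if torusSiteParity L hL (t : TorusSite d L) = 0 then (1 : ℝ) else -1 : ℝ)) : ℂ) • siteSpin n t 2 with hFs
  -- the conjugated Hamiltonian in Kronecker form
  have hK₀ : xyzRealFieldHamiltonian L n (s ^ 2) (-(s ^ 2)) (0 : TorusSite d L → ℝ) =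
      (A₀ ⊗ₖ (1 : Op (torusLeftHalf L j a) (n + 1)) + (1 : Op (torusLeftHalf L j a) (n + 1)) ⊗ₖ A₀ -
        ∑ i, M₀ i ⊗ₖ M₀ i).submatrix e e :=
    xyzRealFieldHamiltonian_eq_submatrix L j a hL n s s 0
  have hconj : U * xxzHamiltonian n (torusGraph d L) J Δ * Uᴴ =
      (A ⊗ₖ (1 : Op (torusLeftHalf L j a) (n + 1)) + (1 : Op (torusLeftHalf L j a) (n + 1)) ⊗ₖ A -
        ∑ i, M i ⊗ₖ M i).submatrix e e := by
    rw [hUdef, hconjR J Δ hΔ.ne', ← hs2, hK₀, ← submatrix_smul_pt, smul_kroneckerForm A₀ M₀ hr2]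
  -- the conjugated charge
  have hUz : ∀ x : TorusSite d L, U * siteSpin n x 2 * Uᴴ =
      (((if torusSiteParity L hL x = 0 then (1 : ℝ) else -1 : ℝ)) : ℂ) • siteSpin n x 2 := by
    intro x
    rw [hUdef, siteSpin, productOp_conj_onSite hua, ← onSite_smul']
    congr 1
    simp only [hu, hε]
    split_ifs with hx
    · rw [conjTranspose_one, Matrix.mul_one, Matrix.one_mul]
      push_cast
      rw [one_smul]
    · rw [spinVec_two, hRz]
      push_cast
      rw [neg_one_smul]
  have hconjS : U * totalSpin n 2 * Uᴴ =
      (Fs ⊗ₖ (1 : Op (torusLeftHalf L j a) (n + 1)) +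
        (1 : Op (torusLeftHalf L j a) (n + 1)) ⊗ₖ (-Fs)).submatrix e e := by
    rw [totalSpin, Finset.mul_sum, Finset.sum_mul, Finset.sum_congr rfl fun x _ => hUz x]
    exact stagCharge_eq_submatrix L hL j a n
  have hH := xxzHamiltonian_isHermitian n (torusGraph d L) J Δ
  have hK : (A ⊗ₖ (1 : Op (torusLeftHalf L j a) (n + 1)) + (1 : Op (torusLeftHalf L j a) (n + 1)) ⊗ₖ A -
      ∑ i, M i ⊗ₖ M i).IsHermitian := by
    have h := (Matrix.isHermitian_mul_mul_conjTranspose U hH).submatrix e.symm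
    rw [hconj, submatrix_submatrix, Equiv.self_comp_symm, submatrix_id_id] at h
    exact h
  have hAt : Aᵀ = A := by
    rw [hA, transpose_smul, hA₀, xyzLeftHamiltonian_transpose]
  have hMt : ∀ i, (M i)ᵀ = (M i)ᴴ := fun i =>
    transpose_eq_conjTranspose_ofReal_smul (xyzCrossOp_transpose_eq L j a n hL s s 0 i) r
  have hFst : Fsᵀ = Fs := by rw [hFs]; exact stagChargeLeft_transpose L hL j a n
  have hFsh : Fsᴴ = Fs := by rw [hFs]; exact (stagChargeLeft_isHermitian L hL j a n).eq
  haveI : Nonempty (torusLeftHalf L j a → Fin (n + 1)) := ⟨fun _ => 0⟩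
  -- the ground state in the Kronecker picture
  have hφ := HardCoreBoson.mem_groundSpace_conj_transport e hK hU hU' hconj hψ
  have hφ0 : (U *ᵥ ψ) ∘ e.symm ≠ 0 := by
    intro h
    apply hψ0
    have h1 : U *ᵥ ψ = 0 := by
      have h' : U *ᵥ ψ = ((U *ᵥ ψ) ∘ e.symm) ∘ e := by
        rw [Function.comp_assoc, Equiv.symm_comp_self, Function.comp_id]
      rw [h', h]
      rfl
    calc ψ = Uᴴ *ᵥ (U *ᵥ ψ) := by rw [mulVec_mulVec, hU', one_mulVec]
      _ = 0 := by rw [h1, mulVec_zero]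
  have hQφ : (Fs ⊗ₖ (1 : Op (torusLeftHalf L j a) (n + 1)) + (1 : Op (torusLeftHalf L j a) (n + 1)) ⊗ₖ (-Fs)) *ᵥ
      ((U *ᵥ ψ) ∘ e.symm) = μ • ((U *ᵥ ψ) ∘ e.symm) := by
    rw [HardCoreBoson.mulVec_conj_transport e hU' hconjS, hS, mulVec_smul]
    rfl
  -- uniqueness in the sector `S' = 0`, transported from `groundState_totalSpin_zero_unique_xxzAF`
  have huniq : ∀ φ₁ φ₂ : (torusLeftHalf L j a → Fin (n + 1)) × (torusLeftHalf L j a → Fin (n + 1)) → ℂ,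
      φ₁ ∈ (A ⊗ₖ (1 : Op (torusLeftHalf L j a) (n + 1)) + (1 : Op (torusLeftHalf L j a) (n + 1)) ⊗ₖ A -
        ∑ i, M i ⊗ₖ M i).groundSpace →
      φ₂ ∈ (A ⊗ₖ (1 : Op (torusLeftHalf L j a) (n + 1)) + (1 : Op (torusLeftHalf L j a) (n + 1)) ⊗ₖ A -
        ∑ i, M i ⊗ₖ M i).groundSpace →
      (Fs ⊗ₖ (1 : Op (torusLeftHalf L j a) (n + 1)) + (1 : Op (torusLeftHalf L j a) (n + 1)) ⊗ₖ (-Fs)) *ᵥ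
        φ₁ = 0 →
      (Fs ⊗ₖ (1 : Op (torusLeftHalf L j a) (n + 1)) + (1 : Op (torusLeftHalf L j a) (n + 1)) ⊗ₖ (-Fs)) *ᵥ
        φ₂ = 0 →
      φ₁ ≠ 0 → ∃ c : ℂ, φ₂ = c • φ₁ := by
    intro φ₁ φ₂ h₁ h₂ hQ₁ hQ₂ h₁0
    have g₁ := HardCoreBoson.mem_groundSpace_conj_transport_symm e hK hU hU' hconj h₁
    have g₂ := HardCoreBoson.mem_groundSpace_conj_transport_symm e hK hU hU' hconj h₂
    have s₁ : totalSpin n 2 *ᵥ (Uᴴ *ᵥ (φ₁ ∘ e)) = 0 := by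
      rw [HardCoreBoson.mulVec_conj_transport_symm e hU hU' hconjS, hQ₁]
      exact mulVec_zero _
    have s₂ : totalSpin n 2 *ᵥ (Uᴴ *ᵥ (φ₂ ∘ e)) = 0 := by
      rw [HardCoreBoson.mulVec_conj_transport_symm e hU hU' hconjS, hQ₂]
      exact mulVec_zero _
    have n₁ : Uᴴ *ᵥ (φ₁ ∘ e) ≠ 0 := by
      intro h
      apply h₁0
      rw [← conj_transport_roundtrip' e hU φ₁, h, mulVec_zero]
      rfl
    obtain ⟨c', hc'⟩ := groundState_totalSpin_zero_unique_xxzAF L hd hL n hJ hΔ g₁ g₂ s₁ s₂ n₁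
    refine ⟨c', ?_⟩
    calc φ₂ = (U *ᵥ (Uᴴ *ᵥ (φ₂ ∘ e))) ∘ e.symm := (conj_transport_roundtrip' e hU φ₂).symm
      _ = (U *ᵥ (c' • (Uᴴ *ᵥ (φ₁ ∘ e)))) ∘ e.symm := by rw [hc']
      _ = c' • ((U *ᵥ (Uᴴ *ᵥ (φ₁ ∘ e))) ∘ e.symm) := by rw [mulVec_smul]; rfl
      _ = c' • φ₁ := by rw [conj_transport_roundtrip' e hU φ₁]
  exact Matrix.kroneckerGroundState_charge_eigenvalue_eq_zero A M hAt hMt hK Fs hFst hFsh huniq hφ hφ0 hQφ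

/-- **Every ground state of the XXZ antiferromagnet has `Sᶻ_tot = 0`** (`C_Λ Φ = 0`, KT94 (3.3)): the ground
space lies in the sector `Sᶻ_tot = 0`.  Decompose `ψ` into weight components; each nonzero component is a ground
state (`xxzHamiltonian_mulVec_component`) and an eigenvector of `Sᶻ_tot`, hence has magnetisation `0`.
[cite: KomaTasaki1994, §3.2 (3.3)] [cite: AizenmanEtAl2004, Appendix A] -/
theorem groundState_totalSpin_eq_zero_xxzAF (hd : 0 < d) (hL : Even L) (n : ℕ) {J Δ : ℝ} (hJ : 0 < J)
    (hΔ : 0 < Δ) {ψ : TensorIndex (TorusSite d L) (n + 1) → ℂ}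
    (hψ : ψ ∈ (xxzHamiltonian n (torusGraph d L) J Δ).groundSpace) : totalSpin n 2 *ᵥ ψ = 0 := by
  have key : ∀ W : ℕ,
      totalSpin n 2 *ᵥ (fun σ => if (∑ z, (σ z : ℕ)) = W then ψ σ else 0) = 0 := by
    intro W
    have hmem := LiebMattis.component_mem n ψ W
    have hSW : totalSpin (Λ := TorusSite d L) n 2 *ᵥ
        (fun σ => if (∑ z, (σ z : ℕ)) = W then ψ σ else 0) =
        (((((Fintype.card (TorusSite d L) * n : ℕ) : ℝ) / 2 - W : ℝ)) : ℂ) •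
          fun σ => if (∑ z, (σ z : ℕ)) = W then ψ σ else 0 := by
      rw [spinZSector, Module.End.mem_eigenspace_iff, Matrix.toLin'_apply] at hmem
      exact hmem
    have hgsW : (fun σ => if (∑ z, (σ z : ℕ)) = W then ψ σ else 0) ∈
        (xxzHamiltonian n (torusGraph d L) J Δ).groundSpace := by
      rw [Matrix.mem_groundSpace_iff]
      exact LiebMattis.xxzHamiltonian_mulVec_component n _ J Δ ((Matrix.mem_groundSpace_iff _ _).1 hψ) W
    by_cases h0 : (fun σ => if (∑ z, (σ z : ℕ)) = W then ψ σ else 0) = 0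
    · rw [h0, mulVec_zero]
    · rw [hSW, groundState_totalSpin_eigenvalue_eq_zero_xxzAF L hd hL n hJ hΔ hgsW h0 hSW, zero_smul]
  calc totalSpin n 2 *ᵥ ψ
      = totalSpin n 2 *ᵥ ∑ W ∈ Finset.range (Fintype.card (TorusSite d L) * n + 1),
          (fun σ => if (∑ z, (σ z : ℕ)) = W then ψ σ else 0) := by rw [LiebMattis.sum_components n ψ]
    _ = ∑ W ∈ Finset.range (Fintype.card (TorusSite d L) * n + 1),
          totalSpin n 2 *ᵥ (fun σ => if (∑ z, (σ z : ℕ)) = W then ψ σ else 0) := mulVec_sum _ _ _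
    _ = 0 := Finset.sum_eq_zero fun W _ => key W

/-- The ground space of the XXZ antiferromagnet lies in the sector `Sᶻ_tot = 0`. [cite: KomaTasaki1994, §3.2 (3.3)] -/
theorem groundSpace_le_spinZSector_zero_xxzAF (hd : 0 < d) (hL : Even L) (n : ℕ) {J Δ : ℝ} (hJ : 0 < J)
    (hΔ : 0 < Δ) :
    (xxzHamiltonian n (torusGraph d L) J Δ).groundSpace ≤ spinZSector (Λ := TorusSite d L) n 0 := by
  intro ψ hψ
  rw [spinZSector, Module.End.mem_eigenspace_iff, Matrix.toLin'_apply,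
    groundState_totalSpin_eq_zero_xxzAF L hd hL n hJ hΔ hψ, Complex.ofReal_zero, zero_smul]

/-- **THE XXZ ANTIFERROMAGNET ON THE EVEN TORUS HAS A UNIQUE GROUND STATE** (Koma–Tasaki 1994 §3.2: «When `L` is
finite, the ground state `Φ` of the Hamiltonian [`Σ ½Σ_y (S¹_xS¹_y + S²_xS²_y + λS³_xS³_y)`, `0 ≤ λ ≤ 1`] is rigorously
known [Marshall, Lieb–Mattis, Affleck–Lieb] to be unique and satisfies `C_Λ Φ = 0`»): for every `d ≥ 1`, even `L`,
every spin `S = n/2`, `J > 0` and EVERY anisotropy `Δ > 0` (planar `0 < Δ < 1`, isotropic `Δ = 1` = Lieb–Mattis /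
the tree's `hasUniqueGroundState_heisenbergAF`, and Ising-like `Δ > 1` alike), the ground space of
`xxzHamiltonian n (torusGraph d L) J Δ` is one-dimensional (and lies in `Sᶻ_tot = 0`, `groundSpace_le_spinZSector_zero_xxzAF`).
Our proof is Aizenman–Lieb–Seiringer–Solovej–Yngvason's Appendix A argument (Perron–Frobenius in the sectors +
reflection positivity), which covers the anisotropic case where the Lieb–Mattis ordering of energy levels is unavailable;
the `XY` point `Δ = 0`, `S = ½` is the tree's `HardCoreBoson.hasUniqueGroundState_hardCoreLatticeGas`.
[cite: KomaTasaki1994, §3.2 (3.3) and the sentence before it] [cite: AizenmanEtAl2004, Appendix A] [cite: LiebMattis1962, Theorem 2] -/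
theorem hasUniqueGroundState_xxzAF (hd : 0 < d) (hL : Even L) (n : ℕ) {J Δ : ℝ} (hJ : 0 < J) (hΔ : 0 < Δ) :
    (xxzHamiltonian n (torusGraph d L) J Δ).HasUniqueGroundState := by
  obtain ⟨ψ, hψ0, hψ, hS⟩ := exists_groundState_totalSpin_eq_zero_xxzAF L hd hL n hJ hΔ
  rw [Matrix.HasUniqueGroundState, Matrix.groundStateDegeneracy]
  have hv0 : (⟨ψ, hψ⟩ : (xxzHamiltonian n (torusGraph d L) J Δ).groundSpace) ≠ 0 :=
    fun h => hψ0 (congrArg Subtype.val h)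
  refine (finrank_eq_one_iff_of_nonzero' _ hv0).2 fun w => ?_
  obtain ⟨c, hc⟩ := groundState_totalSpin_zero_unique_xxzAF L hd hL n hJ hΔ hψ w.2 hS
    (groundState_totalSpin_eq_zero_xxzAF L hd hL n hJ hΔ w.2) hψ0
  exact ⟨c, Subtype.ext (by simpa using hc.symm)⟩

/-- **KT94 §3.2, the finite-volume input of the Anderson tower, for every `0 < Δ`**: the ground state is unique and
annihilated by `C_Λ = Sᶻ_tot` (in every spin direction `α` when `Δ = 1`, `totalSpin_mulVec_eq_zero_of_heisenberg_groundState`).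
[cite: KomaTasaki1994, §3.2 (3.3)] -/
theorem komaTasaki_groundState_unique_and_charge_zero (hd : 0 < d) (hL : Even L) (n : ℕ) {J Δ : ℝ} (hJ : 0 < J)
    (hΔ : 0 < Δ) :
    (xxzHamiltonian n (torusGraph d L) J Δ).HasUniqueGroundState ∧
      ∀ Φ : TensorIndex (TorusSite d L) (n + 1) → ℂ,
        xxzHamiltonian n (torusGraph d L) J Δ *ᵥ Φ = ((xxzHamiltonian n (torusGraph d L) J Δ).groundEnergy : ℂ) • Φ →
          totalSpin n 2 *ᵥ Φ = 0 :=
  ⟨hasUniqueGroundState_xxzAF L hd hL n hJ hΔ, fun _ hΦ =>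
    groundState_totalSpin_eq_zero_xxzAF L hd hL n hJ hΔ ((Matrix.mem_groundSpace_iff _ _).2 hΦ)⟩

end GroundState

/-! ### §4 The payoff: the Anderson tower of states of the XXZ antiferromagnet for EVERY `0 < Δ ≤ 1` (KT94 §3.2) -/

section Tower

open _root_.Filter WithLp

variable {d : ℕ}

/-- A vector of unit norm is nonzero. [folklore] -/
private theorem ne_zero_of_dotProduct_eq_one' {m : Type*} [Fintype m] {ψ : m → ℂ} (h : star ψ ⬝ᵥ ψ = 1) : ψ ≠ 0 := by
  rintro rfl
  rw [dotProduct_zero] at h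
  exact zero_ne_one h

/-- **THE ANDERSON TOWER OF STATES OF THE XXZ ANTIFERROMAGNET, `0 < Δ ≤ 1`, conditional on KT94 Theorem 2.4 BY NAME
(`h24 : KomaTasaki.theorem_2_4`, a theorem of the tree).**  For `S = n/2 ≥ ½`, `J > 0`, `0 < Δ ≤ 1`, `d ≥ 2` with
`(d, S) ≠ (2, ½)` (the cases in which the tree proves planar ground-state long-range order by reflection positivity,
`xxzAF_ground_planar_of_ne_x`): there are constants `c₂ > 0`, `c₃` such that for all sufficiently large even tori
`(ℤ/(2k+2)ℤ)^d` and every integer `M ≠ 0` with `M² ≤ c₂ N_k`, the sector `Sᶻ_tot = M` is nonempty and its lowest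
energy satisfies `E_k(M) - E_k(0) ≤ c₃ M²/N_k`.  This is KT94 Corollary 2.11 applied in §3.2 to the model (3.2) for the
WHOLE printed range of anisotropies (the tree's `heisenbergAF_andersonTower` is `Δ = 1`): hypotheses iv)–vi) of
Theorem 2.4 are the LRO, `C_ΛΦ = 0` (`groundState_totalSpin_eq_zero_xxzAF`) and the uniqueness of the ground state
(`hasUniqueGroundState_xxzAF`, giving `UΦ ∝ Φ` via `rotation_one_apply_eq_smul_of_hasUniqueGroundState`).
[cite: KomaTasaki1994, Corollary 2.11 and §3.2 (3.2)–(3.3) ("there are low-lying eigenstates with excitation energies not larger than of order N⁻¹")]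
[cite: Tasaki2019Tower, Theorem 3.1 (3.9), Corollary 3.2 (3.11)] -/
theorem xxzAF_andersonTower (h24 : KomaTasaki.theorem_2_4.{0, 0}) (hd : 2 ≤ d) {n : ℕ} (hn : 1 ≤ n)
    (hdn : ¬ (d = 2 ∧ n = 1)) {J Δ : ℝ} (hJ : 0 < J) (hΔ0 : 0 < Δ) (hΔ1 : Δ ≤ 1) :
    ∃ c₂ c₃ : ℝ, 0 < c₂ ∧ ∀ᶠ k : ℕ in atTop, ∀ M : ℤ, M ≠ 0 →
      (M : ℝ) ^ 2 ≤ c₂ * Fintype.card (TorusSite d (2 * k + 2)) →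
        spinZSector (Λ := TorusSite d (2 * k + 2)) n (M : ℝ) ≠ ⊥ ∧
        lowestEnergyInSector n (xxzHamiltonian n (torusGraph d (2 * k + 2)) J Δ) M -
            (xxzHamiltonian n (torusGraph d (2 * k + 2)) J Δ).groundEnergy ≤
          c₃ * (M : ℝ) ^ 2 / Fintype.card (TorusSite d (2 * k + 2)) := by
  have hd0 : 0 < d := by omega
  obtain ⟨a, ha, hev⟩ := exists_pos_eventually_le_of_hasStaggeredEvenTorusLRO (d := d)
    (xxzAF_ground_planar_of_ne_x hd hn hdn hJ hΔ0.le hΔ1)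
  set μ : ℝ := Real.sqrt a / sNorm n with hμ_def
  have hs : 0 < sNorm n := lt_of_lt_of_le zero_lt_one (one_le_sNorm n)
  have hμ : 0 < μ := div_pos (Real.sqrt_pos.2 ha) hs
  refine ⟨min (μ ^ 2 / (192 * ((2 * d + 2 : ℕ) : ℝ))) (sNorm n * μ / Real.sqrt 24),
    h24.choose (hbar d n J Δ) (sNorm n) (2 * d + 2) μ 1, ?_, ?_⟩
  · refine lt_min (div_pos (pow_pos hμ 2) (by positivity)) (div_pos (mul_pos hs hμ) (by positivity))
  filter_upwards [hev] with k hk M hM0 hM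
  have hL : Even (2 * k + 2) := ⟨k + 1, by ring⟩
  set H₀ := xxzHamiltonian n (torusGraph d (2 * k + 2)) J Δ with hH₀
  have hH₀herm : H₀.IsHermitian := xxzHamiltonian_isHermitian n _ J Δ
  obtain ⟨Φ, hΦ, hHΦ, -, hlroΦ⟩ := Matrix.exists_groundState_eigenvector_re_ge hH₀herm
    (totalSpin_isHermitian n 2) (HardCoreBoson.commute_xxzHamiltonian_totalSpin_two n _ J Δ).eq
    (stagSpin n (torusParityExp d (2 * k + 2)) 0 * stagSpin n (torusParityExp d (2 * k + 2)) 0)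
  have hlro' : (μ * sNorm n * (Fintype.card (TorusSite d (2 * k + 2)) : ℝ)) ^ 2 ≤
      (star Φ ⬝ᵥ (stagSpin n (torusParityExp d (2 * k + 2)) 0 *ᵥ
        (stagSpin n (torusParityExp d (2 * k + 2)) 0 *ᵥ Φ))).re := by
    rw [hμ_def, div_mul_cancel₀ _ hs.ne', mul_pow, Real.sq_sqrt ha.le, Matrix.mulVec_mulVec]
    exact hk.trans hlroΦ
  have hC0 : totalSpin n 2 *ᵥ Φ = 0 :=
    groundState_totalSpin_eq_zero_xxzAF (2 * k + 2) hd0 hL n hJ hΔ0 ((Matrix.mem_groundSpace_iff _ _).2 hHΦ)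
  have hUΦ := rotation_one_apply_eq_smul_of_hasUniqueGroundState d (2 * k + 2) n J Δ (torusParityExp d (2 * k + 2))
    (ne_zero_of_dotProduct_eq_one' hΦ) hHΦ (hasUniqueGroundState_xxzAF (2 * k + 2) hd0 hL n hJ hΔ0)
  have h := lowestEnergyInSector_le_of_lro d (2 * k + 2) n h24 J Δ (torusParityExp d (2 * k + 2)) hΦ hHΦ hC0 hμ
    hlro' hUΦ hM0 hM
  refine ⟨h.1, ?_⟩
  have h2 := h.2
  rw [mul_div_assoc] at h2 ⊢
  linarith

/-- **THE ANDERSON TOWER OF THE XXZ ANTIFERROMAGNET, `0 < Δ ≤ 1`, UNCONDITIONALLY** (`h24 := KomaTasaki.theorem_2_4_holds`).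
[cite: KomaTasaki1994, Corollary 2.11, §3.2] [cite: Tasaki2019Tower, Corollary 3.2] -/
theorem xxzAF_andersonTower_holds (hd : 2 ≤ d) {n : ℕ} (hn : 1 ≤ n) (hdn : ¬ (d = 2 ∧ n = 1)) {J Δ : ℝ}
    (hJ : 0 < J) (hΔ0 : 0 < Δ) (hΔ1 : Δ ≤ 1) :
    ∃ c₂ c₃ : ℝ, 0 < c₂ ∧ ∀ᶠ k : ℕ in atTop, ∀ M : ℤ, M ≠ 0 →
      (M : ℝ) ^ 2 ≤ c₂ * Fintype.card (TorusSite d (2 * k + 2)) →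
        spinZSector (Λ := TorusSite d (2 * k + 2)) n (M : ℝ) ≠ ⊥ ∧
        lowestEnergyInSector n (xxzHamiltonian n (torusGraph d (2 * k + 2)) J Δ) M -
            (xxzHamiltonian n (torusGraph d (2 * k + 2)) J Δ).groundEnergy ≤
          c₃ * (M : ℝ) ^ 2 / Fintype.card (TorusSite d (2 * k + 2)) :=
  xxzAF_andersonTower KomaTasaki.theorem_2_4_holds hd hn hdn hJ hΔ0 hΔ1

/-- **The low-lying eigenstates themselves, `0 < Δ ≤ 1`** (KT94 Corollary 2.11 as printed: an eigenstate `Φ_Λ^{(M)}` with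
`Sᶻ_tot = M`, orthogonal to the ground state, `E^{(M)} - E^{(0)} ≤ c₃M²/N`), unconditionally.
[cite: KomaTasaki1994, Corollary 2.11, §3.2] -/
theorem xxzAF_andersonTower_eigenstates_holds (hd : 2 ≤ d) {n : ℕ} (hn : 1 ≤ n) (hdn : ¬ (d = 2 ∧ n = 1))
    {J Δ : ℝ} (hJ : 0 < J) (hΔ0 : 0 < Δ) (hΔ1 : Δ ≤ 1) :
    ∃ c₂ c₃ : ℝ, 0 < c₂ ∧ ∀ᶠ k : ℕ in atTop, ∀ M : ℤ, M ≠ 0 →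
      (M : ℝ) ^ 2 ≤ c₂ * Fintype.card (TorusSite d (2 * k + 2)) →
        ∃ (Ψ : TensorIndex (TorusSite d (2 * k + 2)) (n + 1) → ℂ) (E : ℝ), star Ψ ⬝ᵥ Ψ = 1 ∧
          totalSpin n 2 *ᵥ Ψ = (M : ℂ) • Ψ ∧ xxzHamiltonian n (torusGraph d (2 * k + 2)) J Δ *ᵥ Ψ = (E : ℂ) • Ψ ∧
          (∀ Φ₀ : TensorIndex (TorusSite d (2 * k + 2)) (n + 1) → ℂ,
            xxzHamiltonian n (torusGraph d (2 * k + 2)) J Δ *ᵥ Φ₀ =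
              ((xxzHamiltonian n (torusGraph d (2 * k + 2)) J Δ).groundEnergy : ℂ) • Φ₀ → star Φ₀ ⬝ᵥ Ψ = 0) ∧
          E - (xxzHamiltonian n (torusGraph d (2 * k + 2)) J Δ).groundEnergy ≤
            c₃ * (M : ℝ) ^ 2 / Fintype.card (TorusSite d (2 * k + 2)) := by
  have hd0 : 0 < d := by omega
  obtain ⟨c₂, c₃, hc₂, hev⟩ := xxzAF_andersonTower_holds hd hn hdn hJ hΔ0 hΔ1
  refine ⟨c₂, c₃, hc₂, ?_⟩
  filter_upwards [hev] with k hk M hM0 hM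
  obtain ⟨hne, hEM⟩ := hk M hM0 hM
  have hL : Even (2 * k + 2) := ⟨k + 1, by ring⟩
  set H₀ := xxzHamiltonian n (torusGraph d (2 * k + 2)) J Δ with hH₀
  obtain ⟨Ψ, hΨmem, hΨ1, hHΨ⟩ := exists_eigenvector_lowestEnergyInSector
    (xxzHamiltonian_isHermitian n (torusGraph d (2 * k + 2)) J Δ)
    (HardCoreBoson.commute_xxzHamiltonian_totalSpin_two n (torusGraph d (2 * k + 2)) J Δ) hne
  have hCΨ : totalSpin n 2 *ᵥ Ψ = (M : ℂ) • Ψ := by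
    simp only [spinZSector, Module.End.mem_eigenspace_iff, Matrix.toLin'_apply, Complex.ofReal_intCast] at hΨmem
    exact hΨmem
  refine ⟨Ψ, lowestEnergyInSector n H₀ M, hΨ1, hCΨ, hHΨ, fun Φ₀ hΦ₀ => ?_, hEM⟩
  have hC0 : totalSpin n 2 *ᵥ Φ₀ = 0 :=
    groundState_totalSpin_eq_zero_xxzAF (2 * k + 2) hd0 hL n hJ hΔ0 ((Matrix.mem_groundSpace_iff _ _).2 hΦ₀)
  have h1 : star Φ₀ ⬝ᵥ (totalSpin n 2 *ᵥ Ψ) = (M : ℂ) * (star Φ₀ ⬝ᵥ Ψ) := by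
    rw [hCΨ, dotProduct_smul, smul_eq_mul]
  have h2 : star Φ₀ ⬝ᵥ (totalSpin n 2 *ᵥ Ψ) = 0 := by
    have e : star Φ₀ ᵥ* totalSpin n 2 = star (totalSpin n 2 *ᵥ Φ₀) := by
      rw [star_mulVec, (totalSpin_isHermitian n 2).eq]
    rw [dotProduct_mulVec, e, hC0, star_zero, zero_dotProduct]
  rw [h2] at h1
  have hM0' : (M : ℂ) ≠ 0 := by exact_mod_cast hM0
  exact (mul_eq_zero.1 h1.symm).resolve_left hM0'

/-- **The tower from ANY certified planar ground-state long-range order** (the abstract form of the two theorems above: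
KT94 Corollary 2.11 for the XXZ antiferromagnet with `J > 0`, `Δ > 0` on the even tori of `ℤ^d`, `d ≥ 1`, given staggered
`x–x` ground-state LRO as the tree's `HasStaggeredEvenTorusLRO`).  Uniqueness and `C_ΛΦ = 0` are supplied by this file for
every `Δ > 0`, so the only model-dependent input left is the long-range order. [cite: KomaTasaki1994, Corollary 2.11, §3.2] -/
theorem xxzAF_andersonTower_of_lro (h24 : KomaTasaki.theorem_2_4.{0, 0}) (hd0 : 0 < d) (n : ℕ) {J Δ : ℝ} (hJ : 0 < J)
    (hΔ0 : 0 < Δ) (hlro : HasStaggeredEvenTorusLRO (fun L x y => groundStateXXZCorrTorus 0 (d := d) L n J Δ x y)) :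
    ∃ c₂ c₃ : ℝ, 0 < c₂ ∧ ∀ᶠ k : ℕ in atTop, ∀ M : ℤ, M ≠ 0 →
      (M : ℝ) ^ 2 ≤ c₂ * Fintype.card (TorusSite d (2 * k + 2)) →
        spinZSector (Λ := TorusSite d (2 * k + 2)) n (M : ℝ) ≠ ⊥ ∧
        lowestEnergyInSector n (xxzHamiltonian n (torusGraph d (2 * k + 2)) J Δ) M -
            (xxzHamiltonian n (torusGraph d (2 * k + 2)) J Δ).groundEnergy ≤
          c₃ * (M : ℝ) ^ 2 / Fintype.card (TorusSite d (2 * k + 2)) := by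
  obtain ⟨a, ha, hev⟩ := exists_pos_eventually_le_of_hasStaggeredEvenTorusLRO (d := d) hlro
  set μ : ℝ := Real.sqrt a / sNorm n with hμ_def
  have hs : 0 < sNorm n := lt_of_lt_of_le zero_lt_one (one_le_sNorm n)
  have hμ : 0 < μ := div_pos (Real.sqrt_pos.2 ha) hs
  refine ⟨min (μ ^ 2 / (192 * ((2 * d + 2 : ℕ) : ℝ))) (sNorm n * μ / Real.sqrt 24),
    h24.choose (hbar d n J Δ) (sNorm n) (2 * d + 2) μ 1, ?_, ?_⟩
  · refine lt_min (div_pos (pow_pos hμ 2) (by positivity)) (div_pos (mul_pos hs hμ) (by positivity))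
  filter_upwards [hev] with k hk M hM0 hM
  have hL : Even (2 * k + 2) := ⟨k + 1, by ring⟩
  set H₀ := xxzHamiltonian n (torusGraph d (2 * k + 2)) J Δ with hH₀
  have hH₀herm : H₀.IsHermitian := xxzHamiltonian_isHermitian n _ J Δ
  obtain ⟨Φ, hΦ, hHΦ, -, hlroΦ⟩ := Matrix.exists_groundState_eigenvector_re_ge hH₀herm
    (totalSpin_isHermitian n 2) (HardCoreBoson.commute_xxzHamiltonian_totalSpin_two n _ J Δ).eq
    (stagSpin n (torusParityExp d (2 * k + 2)) 0 * stagSpin n (torusParityExp d (2 * k + 2)) 0)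
  have hlro' : (μ * sNorm n * (Fintype.card (TorusSite d (2 * k + 2)) : ℝ)) ^ 2 ≤
      (star Φ ⬝ᵥ (stagSpin n (torusParityExp d (2 * k + 2)) 0 *ᵥ
        (stagSpin n (torusParityExp d (2 * k + 2)) 0 *ᵥ Φ))).re := by
    rw [hμ_def, div_mul_cancel₀ _ hs.ne', mul_pow, Real.sq_sqrt ha.le, Matrix.mulVec_mulVec]
    exact hk.trans hlroΦ
  have hC0 : totalSpin n 2 *ᵥ Φ = 0 :=
    groundState_totalSpin_eq_zero_xxzAF (2 * k + 2) hd0 hL n hJ hΔ0 ((Matrix.mem_groundSpace_iff _ _).2 hHΦ)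
  have hUΦ := rotation_one_apply_eq_smul_of_hasUniqueGroundState d (2 * k + 2) n J Δ (torusParityExp d (2 * k + 2))
    (ne_zero_of_dotProduct_eq_one' hΦ) hHΦ (hasUniqueGroundState_xxzAF (2 * k + 2) hd0 hL n hJ hΔ0)
  have h := lowestEnergyInSector_le_of_lro d (2 * k + 2) n h24 J Δ (torusParityExp d (2 * k + 2)) hΦ hHΦ hC0 hμ
    hlro' hUΦ hM0 hM
  refine ⟨h.1, ?_⟩
  have h2 := h.2
  rw [mul_div_assoc] at h2 ⊢
  linarith

/-- **THE ANDERSON TOWER OF THE SPIN-½ XXZ ANTIFERROMAGNET ON `ℤ²`, `0 < Δ ≤ 0.15`, UNCONDITIONALLY** — the case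
`(d, S) = (2, ½)` excluded above, where the tree proves planar ground-state long-range order on the certified window
`0 ≤ Δ ≤ 0.15` (`xxzAF_ground_planar_spinHalf_x`, Kennedy–Lieb–Shastry / Kubo–Kishi / Wischmann–Müller-Hartmann); by the
Matsubara–Matsuda dictionary this is the hard-core lattice Bose gas at half filling WITH nearest-neighbour repulsion
`V = 2tΔ ≤ 0.3t` in two dimensions (the tree's `hardCoreBoson_andersonTower_holds` is `V = 0`): `E_k(M) - E_k(0) ≤ c₃M²/N_k`
for `M² ≤ c₂N_k` on all large even tori `(ℤ/(2k+2)ℤ)²`. [cite: KomaTasaki1994, Corollary 2.11, §3.2–§3.3] [cite: KuboKishi1988]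
[cite: Tasaki2019Tower, Corollary 3.2] -/
theorem xxzAF_andersonTower_spinHalf_two_holds {J Δ : ℝ} (hJ : 0 < J) (hΔ0 : 0 < Δ) (hΔ1 : Δ ≤ 0.15) :
    ∃ c₂ c₃ : ℝ, 0 < c₂ ∧ ∀ᶠ k : ℕ in atTop, ∀ M : ℤ, M ≠ 0 →
      (M : ℝ) ^ 2 ≤ c₂ * Fintype.card (TorusSite 2 (2 * k + 2)) →
        spinZSector (Λ := TorusSite 2 (2 * k + 2)) 1 (M : ℝ) ≠ ⊥ ∧
        lowestEnergyInSector 1 (xxzHamiltonian 1 (torusGraph 2 (2 * k + 2)) J Δ) M -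
            (xxzHamiltonian 1 (torusGraph 2 (2 * k + 2)) J Δ).groundEnergy ≤
          c₃ * (M : ℝ) ^ 2 / Fintype.card (TorusSite 2 (2 * k + 2)) :=
  xxzAF_andersonTower_of_lro KomaTasaki.theorem_2_4_holds two_pos 1 hJ hΔ0
    (xxzAF_ground_planar_spinHalf_x J hJ Δ hΔ0.le hΔ1)

end Tower

end XXZKT

end Literature.MathematicalPhysics.QuantumLattice

end
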